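import Summits.QuantumFields.BalabanUV.Beta.GAN24.SymBorderGaugeLegContact
import Summits.QuantumFields.BalabanUV.Beta.GAN24.ContactBorderPartner

/-!
# `GAN24.SymContactBorderPartner` — THE CONTACT PARTNER OF THE SYMMETRISED BORDER TABLE's ONE-GAUGE CELLS: an1's (0.4) packed first-order kernel `q = linSym04At ρ L`
# (support, size `ℓ`), the slot support of `symVhSAt ρ`, the INDEX-slot law in `dψ`-form, and the two contact kernels enveloped at the leg site — the sym twin of leaf-02 g47's
# (E) `GAN24.ContactBorderPartner` (CT-3aV part 1)
NOT IN PRINT — OUR BOOKKEEPING (OWNER `b2b-balaban-gan24-p1` gen 55, 2026-08-28; row G-an2-4 ∕ (CONV-C), TRANSFER-III, the (III′) S-slot (b), born-V contact letter `hCv` of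
road-P2 M.104 — TABLE HALF at an1's (0.4)-SYMMETRISED border table `symVhSAt ρ` (the type of `SymTables.V` at the literal of record), per the OWNER's design memo
`HCV-DESIGN-g55.md` §1: a mkroot-style token re-run of the (E) file named below with `symVhSAt ρ ↦ symVhSAt ρ`, `linSym04At ρ L ↦ linSym04At ρ L` (entries `lin04KerAt = symLinKerAt`,
an1's `lin04KerAt_eq_symLinKerAt`), the rooted Ward laws ↦ leaf-02 g47's `SymBorderGaugeLegContact` ∕ an1-g42's `SymAveragingWardRootedStencils.divV_symVhSAt_apply`, the kernel
support ∕ size ↦ an1's `symVhKerAt_eq_zero_left ∕ _right`, `symLinKerAt_eq_zero`, `abs_symLinKerAt_le` (SAME window `Near`, SAME bound `ℓ`); every TABLE-FREE lemma of the (E)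
file is consumed BY NAME, not copied.  [folklore] bookkeeping; 0 `def`, 0 cited fact, 0 `def … : Prop`, 0 sorry; NO estimate of Bałaban's beyond an1's DEFINED kernels.
HONEST FRAMING (cell contract, verbatim): «discharging `BetaPertH` makes Bałaban's UV stability UNCONDITIONAL — a real constructive-QFT result; it is NOT the continuum limit
and NOT the Clay problem.»  HONEST DEPENDENCY (verbatim): «continuum YM on T⁴ ⇐ BetaPertH ∧ nine spine estimates (0/9 proved); BetaPertH ⇐ (D1) ∧ (D4) ∧ CAP+tail; G-an2-4
gates asym, D1 and NE2/3/4.»  Discharges NO letter of M.104 ∕ of the OWNER's END `CombChargeRowsOfBornContactLetters` (hCv stays a HYPOTHESIS); NEVER «G-an2-4 closed» as (CONV-C);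
NOT D1, NOT BetaPertH, NOT continuum, NOT Clay.  2026-08-28; no existing file touched.

## What (generic `d`; same statements as the (E) file with `symVhSAt ↦ symVhSAt`, `linSym04At ↦ linSym04At`)
§1 `off_eq_zero_and_near_of_linSym04At_ne_zero`, `abs_linSym04At_inl_inr_le` (`≤ ℓ`); §1b `symVhSAt_eq_zero_of_not_mem` (slot support, twin of `LinearGaugeVH.symVhSAt_eq_zero_of_not_mem`);
§2 `tsum_dz_mul_symVhSAt_idx`, `tsum_dz_mul_symVhSAt_idx_inl_inr` (an1-g42's (S-V)⁰⁴ `divV_symVhSAt_apply` by parts); §3 `abs_fluWeight_mul_linSym04At_le`, `abs_idxWeight_mul_linSym04At_le`.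
Table-free letters (`exists_finset_near_card`, `l1_smul_sub_le_of_mem`, `l1_farEnd_sub_le_of_mem`, `abs_weight_le_of_l1_le`) are the (E) file's, BY NAME.
-/

open Finset
open scoped BigOperators Nat
open Literature.MathematicalPhysics.QuantumFieldTheory.LatticeForm (quo)
open Literature.MathematicalPhysics.QuantumFieldTheory.Balaban1983to89
open Literature.MathematicalPhysics.QuantumFieldTheory.Balaban1983to89.Beta
open AffineAveraging AveragingContours AveragingHessianKernels AveragingContoursRooted AveragingHessianKernelsRooted
open B12Sec2to5 (l1 l1_nonneg)
open B4ContourShift (supNorm supNorm_nonneg)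
open ExpKernelCalculus (MKer Zl Zl_nonneg Zl_pos)
open OneStepResolventKernel (Fib)
open StepJetData (mfNeg mfNeg_inl_inl mfNeg_inl_inr mfNeg_inr_inl mfNeg_inr_inr l1_unitVec)
open KernelWard (divV)
open AveragingWardStencils (b6UnitVec_eq)
open Summit.QuantumFields.BalabanUV.Beta.AveragingWardRootedStencils (legSite legInd legInd_apply)
open Summit.QuantumFields.BalabanUV.Beta.SymAveragingHessianCounts (symVhSAt symVhSAt_symm symVhKerAt_eq_zero_left symVhKerAt_eq_zero_right symLinKerAt_eq_zero abs_symLinKerAt_le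
  locStencil_symVhSAt)
open Summit.QuantumFields.BalabanUV.Beta.SymAveragingWardRootedStencils (lin04KerAt_eq_symLinKerAt)
open Summit.QuantumFields.BalabanUV.Beta.DshAn1 (linSym04At linSym04At_inl_inr linSym04At_inr_inl linSym04At_inl_inl linSym04At_inr_inr linSym04At_symm)
open Summit.QuantumFields.BalabanUV.Beta.SymAveragingHessianCounts (symVhSAt symVhSAt_symm symVhKerAt_eq_zero_left symVhKerAt_eq_zero_right symLinKerAt_eq_zero abs_symLinKerAt_le
  locStencil_symVhSAt)
open Summit.QuantumFields.BalabanUV.Beta.SymAveragingWardRootedStencils (lin04KerAt_eq_symLinKerAt)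
open Summit.QuantumFields.BalabanUV.Beta.DshAn1 (linSym04At linSym04At_inl_inr linSym04At_inr_inl linSym04At_inl_inl linSym04At_inr_inr linSym04At_symm)
open Summit.QuantumFields.BalabanUV.Beta.SymAveragingHessianCounts (symVhSAt symVhKerAt_eq_zero_right symLinKerAt_eq_zero abs_symLinKerAt_le)
open Summit.QuantumFields.BalabanUV.Beta.SymAveragingWardRootedStencils (divV_symVhSAt_apply lin04KerAt_eq_symLinKerAt)
open Summit.QuantumFields.BalabanUV.Beta.DshAn1 (linSym04At linSym04At_inl_inr linSym04At_inr_inl)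
open Summit.QuantumFields.BalabanUV.Beta.LinearGaugeVH (nearBox mem_nearBox summable_of_finsupp)
open Summit.QuantumFields.BalabanUV.Beta.GAN24.EnvelopeBlockSum (env_wobble env_le_one summable_env)
open Summit.QuantumFields.BalabanUV.Beta.GAN24.ContactOneGaugeCellBound (tsum_env3_le abs_le_of_env summable_of_env)
open Summit.QuantumFields.BalabanUV.Beta.GAN24.BorderGaugeLegContact (tsum_mul_ite_sub_ite_mul tsum_sum_dz_mul_eq)
open Summit.QuantumFields.BalabanUV.Beta.GAN24.SymBorderGaugeLegContact (tsum_dz_mul_symVhSAt symVhSAt_inl_inr_eq_zero_of_not_mem symVhSAt_inr_inl_eq_zero_of_not_mem summable_mul_symVhSAt summable_mul_symVhSAt_right)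
open Summit.QuantumFields.BalabanUV.Beta.GAN24.SymBorderGaugeLegContact (tsum_dz_mul_symVhSAt symVhSAt_inl_inr_eq_zero_of_not_mem symVhSAt_inr_inl_eq_zero_of_not_mem summable_mul_symVhSAt summable_mul_symVhSAt_right)
open Summit.QuantumFields.BalabanUV.Beta.GAN24.SymBorderGaugeLegContact (tsum_dz_mul_symVhSAt)
open Summit.QuantumFields.BalabanUV.Beta.GAN24.ContactBorderPartner (exists_finset_near_card l1_smul_sub_le_of_mem l1_farEnd_sub_le_of_mem abs_weight_le_of_l1_le)

noncomputable section

namespace Summit.QuantumFields.BalabanUV.Beta.GAN24.SymContactBorderPartner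

variable {d : ℕ}

/-! ## §1 The contact partner's letters: support, size, the finite near-box with its cardinal, proximity -/

section Partner

/-- [folklore] SUPPORT of the packed first-order kernel (box root): a nonzero `(inl κ, inr μ)` entry at `(u, z)` forces `z ∈ L·ℤ^(d+1)` and `u` in the support box
of the block `z/L`. -/
theorem off_eq_zero_and_near_of_linSym04At_ne_zero {L : ℕ} {r : Fin (d + 1) → ℕ} (hr : r ∈ box (d + 1) L) {κ : Fin (d + 1)} {u z : Fin (d + 1) → ℤ}
    {μ : Fin (d + 1)} (h : linSym04At (toSite r) L u z (Sum.inl κ) (Sum.inr μ) ≠ 0) : off L z = 0 ∧ Near L (blk L z) u := by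
  rw [linSym04At_inl_inr] at h
  by_cases hz : off L z = 0
  · refine ⟨hz, ?_⟩
    by_contra hn
    exact h (by rw [if_pos hz, lin04KerAt_eq_symLinKerAt, symLinKerAt_eq_zero hr (f := (κ, u)) hn])
  · exact absurd (by rw [if_neg hz]) h

/-- [folklore] SIZE of the packed first-order kernel (box root): `|q(u, z)(inl κ)(inr μ)| ≤ ℓ = (2d+2)·L` (`abs_lin04KerAt_le`). -/
theorem abs_linSym04At_inl_inr_le {L : ℕ} (hL : 1 ≤ L) {r : Fin (d + 1) → ℕ} (hr : r ∈ box (d + 1) L) (κ : Fin (d + 1)) (u z : Fin (d + 1) → ℤ)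
    (μ : Fin (d + 1)) : |linSym04At (toSite r) L u z (Sum.inl κ) (Sum.inr μ)| ≤ (ell (d + 1) L : ℝ) := by
  rw [linSym04At_inl_inr]
  split_ifs
  · rw [lin04KerAt_eq_symLinKerAt]; exact abs_symLinKerAt_le hL μ (blk L z) hr (κ, u)
  · rw [abs_zero]; positivity




end Partner

/-! ## §1b The slot support of the symmetrised border table -/

/-- [folklore] For a box root `ρ = toSite r`, the entry `u ↦ symVhSAt ρ d L rfl κ′ u x z a b` vanishes unless `u` lies in the support box of the block of `z` or of the block
of `x` (an1's `symVhKerAt_eq_zero_right` through the packer) — the sym twin of `LinearGaugeVH.symVhSAt_eq_zero_of_not_mem`, same shape. -/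
theorem symVhSAt_eq_zero_of_not_mem {L : ℕ} {r : Fin (d + 1) → ℕ} (hr : r ∈ box (d + 1) L) (κ' : Fin (d + 1))
    (x z : Fin (d + 1) → ℤ) (a b : Fib d) {u : Fin (d + 1) → ℤ}
    (hu : u ∉ nearBox L (blk L z) ∪ nearBox L (blk L x)) : symVhSAt (toSite r) d L rfl κ' u x z a b = 0 := by
  rw [Finset.mem_union, not_or, mem_nearBox, mem_nearBox] at hu
  rcases a with α | μ <;> rcases b with α' | μ'
  · simp [symVhSAt]
  · simp only [symVhSAt, packVH_inl_inr]
    split_ifs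
    · exact symVhKerAt_eq_zero_right hr _ (f' := (κ', u)) hu.1
    · rfl
  · simp only [symVhSAt, packVH_inr_inl]
    split_ifs
    · exact symVhKerAt_eq_zero_right hr _ (f' := (κ', u)) hu.2
    · rfl
  · simp [symVhSAt]

/-! ## §2 The index-slot law in `dψ`-form (an1's (S-V)ρ paired with any gauge function) -/

section Idx

/-- [folklore] **THE INDEX-SLOT PURE-GAUGE LAW OF THE ROOTED BORDER TABLE IN `dψ`-FORM** (box root; EVERY ψ): a pure-gauge background `dψ` in the
family index gives `Σ'_u Σ_κ (dz ψ) κ u · symVhSAt ρ κ u x z a b = (ψ(legSite ρ z b) − ψ(legSite ρ x a)) · mfNeg (linSym04At ρ L) x z a b` — an1's (S-V)ρ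
`divV_symVhSAt_apply` summed by parts (the multiplier leg acts at the ROOT `z + ρ` of its contours, a fluctuation leg at its own site). -/
theorem tsum_dz_mul_symVhSAt_idx {L : ℕ} (hL : 1 ≤ L) {r : Fin (d + 1) → ℕ} (hr : r ∈ box (d + 1) L) (x z : Fin (d + 1) → ℤ) (a b : Fib d)
    (ψ : (Fin (d + 1) → ℤ) → ℝ) :
    ∑' u, ∑ κ, dz ψ κ u * symVhSAt (toSite r) d L rfl κ u x z a b
      = (ψ (legSite (toSite r) z b) - ψ (legSite (toSite r) x a)) * mfNeg (linSym04At (toSite r) L) x z a b := by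
  classical
  rw [tsum_sum_dz_mul_eq (fun κ u => symVhSAt (toSite r) d L rfl κ u x z a b)
    (fun κ g => summable_of_finsupp (nearBox L (blk L z) ∪ nearBox L (blk L x)) fun u hu => by
      rw [symVhSAt_eq_zero_of_not_mem hr κ x z a b hu, mul_zero]) ψ]
  have hdiv : ∀ u, (∑ κ, (symVhSAt (toSite r) d L rfl κ (u - unitVec κ) x z a b - symVhSAt (toSite r) d L rfl κ u x z a b))
      = divV (symVhSAt (toSite r) d L rfl) u x z a b := by
    intro u
    simp only [KernelWard.divV, Finset.sum_apply, Pi.sub_apply, b6UnitVec_eq]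
  simp only [hdiv, divV_symVhSAt_apply hL, legInd_apply]
  exact tsum_mul_ite_sub_ite_mul ψ _ _ _

/-- [folklore] The index-slot law read on the `(inl α, inr μ)` block: `(ψ(z + ρ) − ψ x) · linSym04At ρ L x z (inl α) (inr μ)`. -/
theorem tsum_dz_mul_symVhSAt_idx_inl_inr {L : ℕ} (hL : 1 ≤ L) {r : Fin (d + 1) → ℕ} (hr : r ∈ box (d + 1) L) (x z : Fin (d + 1) → ℤ)
    (α μ : Fin (d + 1)) (ψ : (Fin (d + 1) → ℤ) → ℝ) :
    ∑' u, ∑ κ, dz ψ κ u * symVhSAt (toSite r) d L rfl κ u x z (Sum.inl α) (Sum.inr μ)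
      = (ψ (z + toSite r) - ψ x) * linSym04At (toSite r) L x z (Sum.inl α) (Sum.inr μ) := by
  rw [tsum_dz_mul_symVhSAt_idx hL hr]; rfl

end Idx

/-! ## §3 The two contact kernels are enveloped at the leg site -/

section Weights

variable {N L : ℕ} {κ₀ : ℝ} {r : Fin (d + 1) → ℕ}


/-- [folklore] **THE FLUCTUATION-SLOT CONTACT KERNEL IS ENVELOPED**: `|(ψ(u + e_κ) − ψ(z + ρ + L·e_μ))·q(u,z)(inl κ)(inr μ)| ≤ (2·Eψ·e^{2κ₀(d+1)L}·ℓ)·E_{z₀}(u)`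
(both contact sites are within `(d+1)·2L` of `u` wherever `q ≠ 0`; `|q| ≤ ℓ`). -/
theorem abs_fluWeight_mul_linSym04At_le (hN : 1 ≤ N) (hκ : 0 ≤ κ₀) (hL : 1 ≤ L) (hr : r ∈ box (d + 1) L) {ψ : (Fin (d + 1) → ℤ) → ℝ} {Eψ : ℝ}
    (hE : 0 ≤ Eψ) {z₀ : Fin (d + 1) → ℤ} (hψ : ∀ x, |ψ x| ≤ Eψ * Real.exp (-(κ₀ * supNorm (quo N x - z₀))))
    (κ : Fin (d + 1)) (u : Fin (d + 1) → ℤ) (μ : Fin (d + 1)) (z : Fin (d + 1) → ℤ) :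
    |(ψ (u + unitVec κ) - ψ (z + toSite r + (L : ℤ) • unitVec μ)) * linSym04At (toSite r) L u z (Sum.inl κ) (Sum.inr μ)|
      ≤ (2 * Eψ * Real.exp (κ₀ * (((d : ℝ) + 1) * (2 * (L : ℝ)))) * (ell (d + 1) L : ℝ)) * Real.exp (-(κ₀ * supNorm (quo N u - z₀))) := by
  by_cases hq : linSym04At (toSite r) L u z (Sum.inl κ) (Sum.inr μ) = 0
  · rw [hq, mul_zero, abs_zero]; positivity
  obtain ⟨hoff, hnear⟩ := off_eq_zero_and_near_of_linSym04At_ne_zero hr hq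
  obtain ⟨s, _, hs, hprox⟩ := exists_finset_near_card (d := d) hL u
  have hy := hprox (blk L z) (hs _ hnear)
  have hz : z = (L : ℤ) • blk L z := eq_smul_blk_of_off_eq_zero hL hoff
  have hL1 : (1 : ℝ) ≤ ((d : ℝ) + 1) * (2 * (L : ℝ)) := by
    have : (1 : ℝ) ≤ L := by exact_mod_cast hL
    nlinarith [show (0 : ℝ) ≤ d from Nat.cast_nonneg d]
  have htip : l1 (u + unitVec κ - u) ≤ ((d : ℝ) + 1) * (2 * (L : ℝ)) := by
    rw [add_sub_cancel_left, ← b6UnitVec_eq, l1_unitVec]; exact hL1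
  have hfar : l1 (z + toSite r + (L : ℤ) • unitVec μ - u) ≤ ((d : ℝ) + 1) * (2 * (L : ℝ)) := by
    rw [hz]; exact l1_farEnd_sub_le_of_mem hr hy μ
  have h1 := abs_weight_le_of_l1_le hN hκ hE hψ htip
  have h2 := abs_weight_le_of_l1_le hN hκ hE hψ hfar
  have hq' := abs_linSym04At_inl_inr_le hL hr κ u z μ
  rw [abs_mul]
  have h3 : |ψ (u + unitVec κ) - ψ (z + toSite r + (L : ℤ) • unitVec μ)|
      ≤ 2 * Eψ * Real.exp (κ₀ * (((d : ℝ) + 1) * (2 * (L : ℝ)))) * Real.exp (-(κ₀ * supNorm (quo N u - z₀))) := by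
    have := abs_sub (ψ (u + unitVec κ)) (ψ (z + toSite r + (L : ℤ) • unitVec μ))
    linarith
  have h0 : 0 ≤ 2 * Eψ * Real.exp (κ₀ * (((d : ℝ) + 1) * (2 * (L : ℝ)))) * Real.exp (-(κ₀ * supNorm (quo N u - z₀))) := by positivity
  calc |ψ (u + unitVec κ) - ψ (z + toSite r + (L : ℤ) • unitVec μ)| * |linSym04At (toSite r) L u z (Sum.inl κ) (Sum.inr μ)|
      ≤ (2 * Eψ * Real.exp (κ₀ * (((d : ℝ) + 1) * (2 * (L : ℝ)))) * Real.exp (-(κ₀ * supNorm (quo N u - z₀)))) * (ell (d + 1) L : ℝ) :=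
        mul_le_mul h3 hq' (abs_nonneg _) h0
    _ = _ := by ring

/-- [folklore] **THE INDEX-SLOT CONTACT KERNEL IS ENVELOPED**: `|(ψ(z + ρ) − ψ x)·q(x,z)(inl α)(inr μ)| ≤ (2·Eψ·e^{2κ₀(d+1)L}·ℓ)·E_{z₀}(x)`. -/
theorem abs_idxWeight_mul_linSym04At_le (hN : 1 ≤ N) (hκ : 0 ≤ κ₀) (hL : 1 ≤ L) (hr : r ∈ box (d + 1) L) {ψ : (Fin (d + 1) → ℤ) → ℝ} {Eψ : ℝ}
    (hE : 0 ≤ Eψ) {z₀ : Fin (d + 1) → ℤ} (hψ : ∀ x, |ψ x| ≤ Eψ * Real.exp (-(κ₀ * supNorm (quo N x - z₀))))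
    (α : Fin (d + 1)) (x : Fin (d + 1) → ℤ) (μ : Fin (d + 1)) (z : Fin (d + 1) → ℤ) :
    |(ψ (z + toSite r) - ψ x) * linSym04At (toSite r) L x z (Sum.inl α) (Sum.inr μ)|
      ≤ (2 * Eψ * Real.exp (κ₀ * (((d : ℝ) + 1) * (2 * (L : ℝ)))) * (ell (d + 1) L : ℝ)) * Real.exp (-(κ₀ * supNorm (quo N x - z₀))) := by
  by_cases hq : linSym04At (toSite r) L x z (Sum.inl α) (Sum.inr μ) = 0
  · rw [hq, mul_zero, abs_zero]; positivity
  obtain ⟨hoff, hnear⟩ := off_eq_zero_and_near_of_linSym04At_ne_zero hr hq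
  obtain ⟨s, _, hs, hprox⟩ := exists_finset_near_card (d := d) hL x
  have hy := hprox (blk L z) (hs _ hnear)
  have hz : z = (L : ℤ) • blk L z := eq_smul_blk_of_off_eq_zero hL hoff
  have hri : ∀ i, (0 : ℤ) ≤ (r i : ℤ) ∧ (r i : ℤ) < L := by
    intro i
    have := Finset.mem_range.1 (Fintype.mem_piFinset.1 hr i)
    omega
  have hroot : l1 (z + toSite r - x) ≤ ((d : ℝ) + 1) * (2 * (L : ℝ)) := by
    rw [hz]
    unfold l1
    calc ∑ ν, |((((L : ℤ) • blk L z + toSite r - x) ν : ℤ) : ℝ)| ≤ ∑ _ν : Fin (d + 1), 2 * (L : ℝ) := by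
          refine Finset.sum_le_sum fun i _ => ?_
          have h := hy i
          have hr' := hri i
          rw [abs_le]
          simp only [Pi.sub_apply, Pi.add_apply, Pi.smul_apply, smul_eq_mul, toSite]
          push_cast
          have h1 : ((x i : ℤ) : ℝ) - 2 * (L : ℝ) < (L : ℝ) * (blk L z i : ℝ) := by exact_mod_cast h.1
          have h2 : (L : ℝ) * (blk L z i : ℝ) ≤ ((x i : ℤ) : ℝ) := by exact_mod_cast h.2
          have h3 : (0 : ℝ) ≤ ((r i : ℕ) : ℝ) ∧ ((r i : ℕ) : ℝ) < (L : ℝ) := by exact_mod_cast hr'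
          have hL0 : (0 : ℝ) ≤ (L : ℝ) := Nat.cast_nonneg L
          constructor <;> linarith [h3.1, h3.2]
      _ = ((d : ℝ) + 1) * (2 * (L : ℝ)) := by
          rw [Finset.sum_const, Finset.card_univ, Fintype.card_fin, nsmul_eq_mul]; push_cast; ring
  have hsite : l1 (x - x) ≤ ((d : ℝ) + 1) * (2 * (L : ℝ)) := by
    rw [sub_self]; unfold l1; simp; positivity
  have h1 := abs_weight_le_of_l1_le hN hκ hE hψ hroot
  have h2 := abs_weight_le_of_l1_le hN hκ hE hψ hsite
  have hq' := abs_linSym04At_inl_inr_le hL hr α x z μ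
  rw [abs_mul]
  have h3 : |ψ (z + toSite r) - ψ x| ≤ 2 * Eψ * Real.exp (κ₀ * (((d : ℝ) + 1) * (2 * (L : ℝ)))) * Real.exp (-(κ₀ * supNorm (quo N x - z₀))) := by
    have := abs_sub (ψ (z + toSite r)) (ψ x)
    linarith
  have h0 : 0 ≤ 2 * Eψ * Real.exp (κ₀ * (((d : ℝ) + 1) * (2 * (L : ℝ)))) * Real.exp (-(κ₀ * supNorm (quo N x - z₀))) := by positivity
  calc |ψ (z + toSite r) - ψ x| * |linSym04At (toSite r) L x z (Sum.inl α) (Sum.inr μ)|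
      ≤ (2 * Eψ * Real.exp (κ₀ * (((d : ℝ) + 1) * (2 * (L : ℝ)))) * Real.exp (-(κ₀ * supNorm (quo N x - z₀)))) * (ell (d + 1) L : ℝ) :=
        mul_le_mul h3 hq' (abs_nonneg _) h0
    _ = _ := by ring

end Weights

end Summit.QuantumFields.BalabanUV.Beta.GAN24.SymContactBorderPartner

end
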